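import Literature.MathematicalPhysics.QuantumFieldTheory.Balaban1983to89.B9Eq324NearFlatFormComparisonZdPer
import Literature.MathematicalPhysics.QuantumFieldTheory.Balaban1983to89.B9Thm31NearFlatCoerciveClassZd

/-!
# `Balaban1983to89.B9Thm31NearFlatCoerciveClassZdPer` — [Balaban1985BackgroundPropagators] Thm 3.11 p. 416 («uniformly in U») with (3.35) p. 396 ON THE TORUS `T_P` READ
# ON `ℤᵈ`: THE SCALAR REGIME `Δ′_a(U₀)` COERCIVE — HENCE INVERTIBLE ON `L²(T_P)` — AT EVERY BACKGROUND OF AN EXPLICIT SMALL-FIELD CLASS OF THE TORUS, from the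
# class's OWN smallness: unitary `P`-periodic `U₀` with `‖U₀(b) − 1‖ ≤ θ′η` on the bonds and small plaquette deviation `pdev U₀ < α₀L^{−2k}` ([Balaban1985Averaging]
# Prop. 2's class (52)) — the operator-norm and class readings of `B9Eq324NearFlatFormComparisonZdPer.coercive_near_flat_per`, with the tower transporters' unitarity and
# closeness READ OFF the class by dag-n06-w2 g5's `B9Thm31NearFlatTransportersZd` (NE9 area law); the periodic twin of `B9Thm31NearFlatCoerciveClassZd`

statement-level skeleton of published theorems with citation tags; proofs where landed; nothing here is a claim about the
Yang–Mills mass gap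

`[Balaban1985BackgroundPropagators]` ("B9", CMP **99** (1985) 389–434) Thm 3.11 p. 416: *«There exist constants M₀, α₀′ such that for M ≥ M₀, Mα₀ ≤ α₀′ and for U
satisfying (3.35) the operators Δ′_a, G′, … are positive definite … uniformly in U, Ω_j»*; (3.35) p. 396 (the small-field class); (3.24) p. 394 *«Its inverse is denoted
by G′»*.  `[Balaban1985Averaging]` ("B7", CMP **98** (1985) 17–51) Prop. 2 (52)–(54) p. 26, (42)–(43) pp. 23–24, (78)–(80) p. 30 (the averaged configurations and their
transporters on the class).  `[Balaban1984PropagatorsII]` (2.22) p. 226 (the block Poincaré inequality behind the flat constant).  `[Balaban1985RegularSpaces]` p. 77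
*«Ω_j = T_η»*, (1.131) p. 99.  PDF held: `paper:balaban1985-cmp99-background-propagators` pp. 394–396, 416 (re-read by this seat, 2026-08-28).

CITATION HEADER (lean-in-tree rule).  Cell `pub-ymgap` (YM Track A, HUMAN RULING D-0062 ∕ D-0149 width push), DAG node N06 = [B9], width seat `pub-ymgap-dag-n06-w4`
(g6), the (β′-PERIODIC) road.  WHY: Thm 3.11 on the torus for the WHOLE small-field class cannot come from openness at `U₀ = 1` (the class contains flat connections with
non-trivial holonomy, `O(1)` away from `1` in every periodic gauge); it comes from COERCIVITY with explicit constants.  This file closes the scalar half (`Δ′_a`, hence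
`G′`) on the torus: the flat constant of `B9Thm31FlatPoincareCoerciveZdPer` transferred by `B9Eq324NearFlatFormComparisonZdPer`, the `τ`-size hypotheses converted to
operator-norm ones by dag-n06-w4 g5's `fnorm_conjR_sub_le_of_cmp` (with dag-n06-b's norm-comparison constants `C_u, C_l` as displayed hypotheses), and the tower
transporters' unitarity (`j ≤ k`) and closeness supplied by dag-n06-w2 g5's `bgT_mem_unitaryUnits_of_pdev` ∕ `norm_bgT_pair_sub_one_le` ∕ `sum_eps_sq_weight_le` — all
BY NAME; nothing re-declared.  The levels editions (`…PerLevels`) make the class's `j ≤ k` unitarity sufficient (`m ≤ k`).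

WHAT IS PROVED (kernel, 0 sorry; theorems only — no `def`, no `instance`, no `notation`).
* §1 ★★ `coercive_near_flat_per_of_norm` (OPERATOR-NORM READING: unitary periodic `U₀` with `‖U₀(b) − 1‖ ≤ θ′η`, tower transporters unitary for `j ≤ m` with
  `‖Ū₀ⁱ(Γ) − 1‖ ≤ ε′_i` (`i < m`), `a_j(Lᵈ)^{−j}(Σ_{i<j}ε′_i)² ≤ κ′`, a flat coercivity `a₀⟨f,f⟩ ≤ ⟨f, Δ′_a(1)f⟩`:
  `(a₀∕2 − (2C_uC_l)²(dθ′² + κ′(m+1)))·⟨f, f⟩_{T_P} ≤ ⟨f, Δ′_a(U₀)f⟩_{T_P}`).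
* §2 ★★★ `coercive_near_flat_per_of_class` (CLASS READING: unitary periodic `U₀` with `‖U₀(b) − 1‖ ≤ θ′η` and `pdev U₀ < α₀(L^k)^{−2}` (`C0·α₀ ≤ 1∕3`, `2α₀ ≤ c2′`),
  `m ≤ k`, `(L^k)^{−1} ≤ η`, `ηLʲ ≤ 1` and `a_jη²(Lʲ)² ≤ A(Lʲ)ᵈ` for `j ≤ m`: `(a₀∕2 − (2C_uC_l)²(dθ′² + Ad²L²(256(d+1)(d+4)α₀ + θ′)²(m+1)))·⟨f, f⟩ ≤ ⟨f, Δ′_a(U₀)f⟩`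
  — ONE constant for the class), ★★★ `regularPrimePer_of_class` (margin positive ⟹ `Δ′_a(U₀)` INVERTIBLE on `L²(T_P)` at EVERY background of the class — the scalar
  clause of Thm 3.11 «uniformly in U» on the torus), ★★ `coercive_near_flat_per_torusLam_of_class` (the flat constant supplied by `B9Thm31FlatPoincareCoerciveZdPer`:
  level `m` full on the cell, `a₀((Lᵐ))ᵈ ≤ a_mη²(Lᵐ)²`, `a₀ ≤ 8`).
* §3 A6 `coercive_one_per_of_class` (the flat background is in the class: `pdev 1 = 0`, `θ′ = 0`).

HONEST SCOPE.  (i) Scalar operator `Δ′_a` ∕ `G′` only — NOT the vector `Δ_a` of the record (whose class-wide Thm 3.11 needs the vector flat coercivity of the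
`D R D* + Q*aQ` letters, dag-n06-w3's lane); explicit constants in the `L²_τ` currency; the margin's positivity is a DISPLAYED smallness condition on `(θ′, α₀, A, m)`,
not derived from print's `M₀, α₀′`; no decay (Thm 3.1's exponential clause NOT proved).  (ii) `C_u, C_l` displayed (dag-n06-b's `exists_fnorm_cmp` inhabits them on a
finite-dimensional fibre).  (iii) Count-neutral; N05 ∕ N06 NOT discharged; K1⁹ `stmt-QuantumFields-27364` NOT closed; one finite `𝕋⁴` programme at fixed `ε`, Bałaban as
printed; R4 closes only the conditional finite-`𝕋⁴` rung `BalabanLadder.UV` — nothing continuum ∕ ℝ⁴ ∕ OS ∕ mass gap ∕ Clay.  Unit `pub-ymgap-dag-n06-w4` (g6), 2026-08-28.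
-/

noncomputable section

namespace Literature.MathematicalPhysics.QuantumFieldTheory.Balaban1983to89.B9Thm31NearFlatCoerciveClassZdPer

open B7Prop1Explicit
open B7Eq78Linearization (conjR)
open B7Prop2Explicit (unitaryUnits pdev C0 c2')
open B8Eq119TwistedAxial (bgT)
open Literature.MathematicalPhysics.QuantumLattice (blockMap)
open T4TermwiseTorus (IsPeriodic box)
open B9Eq321LandauProjectionZdPer (perSub formPer formPer_apply)
open B9Eq324DeltaPrimeAZdPer (deltaPrimeAPer RegularPrimePer bijective_of_form_pos)
open B9Eq342CombesThomasFormZd (fnorm fnorm_nonneg fnorm_sq)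
open B9Thm31NearFlatCoerciveCubeZd (fnorm_conjR_sub_le_of_cmp)
open B9Thm31NearFlatTransportersZd (norm_bgT_pair_sub_one_le bgT_mem_unitaryUnits_of_pdev sum_eps_sq_weight_le)
open B9Eq324NearFlatFormComparisonZdPer (coercive_near_flat_per)
open B9Thm31FlatPoincareCoerciveZdPer (formPer_deltaPrimeAPer_one_coercive)

-- `Site` alone could resolve to the torus sites of `Setup.lean`; re-export the `ℤ^d` sites of `B7Prop1Explicit`.
export B7Prop1Explicit (Site)

variable {d : ℕ} {𝔸 : Type*} [CStarAlgebra 𝔸] [Nontrivial 𝔸]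
variable (τ : 𝔸 →ₗ[ℂ] ℂ) (hτp : ∀ a : 𝔸, a ≠ 0 → 0 < (τ (star a * a)).re)
  (hτt : ∀ a b : 𝔸, τ (a * b) = τ (b * a)) (hτs : ∀ a : 𝔸, τ (star a) = starRingEnd ℂ (τ a))

/-! ## §1  The operator-norm reading -/

section OperatorNorm

variable {P L : ℕ} [NeZero P] [NeZero L] {η : ℝ} {U₀ : Site d → Fin d → 𝔸ˣ} {m : ℕ} {a : ℕ → ℝ} {Λs : ℕ → Set (Site d)}

include hτp hτt hτs in
/-- ★★ **NEAR-FLAT COERCIVITY ON `L²(T_P)` WITH OPERATOR-NORM HYPOTHESES**: given norm-comparison constants `C_u, C_l` of the `τ`-size, a unitary `P`-periodic `U₀` with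
`‖U₀(b) − 1‖ ≤ θ′η` on all bonds, averaged transporters unitary for `j ≤ m` with `‖Ū₀ⁱ(Γ) − 1‖ ≤ ε′_i` on the tower pairs (`i < m`), weights `a ≥ 0` with
`a_j(Lᵈ)^{−j}(Σ_{i<j}ε′_i)² ≤ κ′` (`j ≤ m`), `Lᵐ ∣ P`, and a flat coercivity `a₀⟨f,f⟩ ≤ ⟨f, Δ′_a(1)f⟩`:
`(a₀∕2 − (2C_uC_l)²(dθ′² + κ′(m+1)))·⟨f, f⟩_{T_P} ≤ ⟨f, Δ′_a(U₀)f⟩_{T_P}` for every `f ∈ L²(T_P, ·)`.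
[cite: Balaban1985BackgroundPropagators, Thm 3.11 p.416, (3.24) p.394, (3.35) p.396; Balaban1985Averaging, (122)–(126) p.36; Balaban1985RegularSpaces, (1.131) p.99, p.77] -/
theorem coercive_near_flat_per_of_norm {Cu Cl : ℝ} (hCu : ∀ b : 𝔸, fnorm τ b ≤ Cu * ‖b‖) (hCl : ∀ b : 𝔸, ‖b‖ ≤ Cl * fnorm τ b) (hCu0 : 0 ≤ Cu) (hCl0 : 0 ≤ Cl)
    (hη : 0 < η) (hUu : ∀ (x : Site d) (κ' : Fin d), U₀ x κ' ∈ unitaryUnits 𝔸) (hU : IsPeriodic P U₀)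
    {θ' : ℝ} (hR : ∀ (x : Site d) (μ : Fin d), ‖((U₀ x μ : 𝔸ˣ) : 𝔸) - 1‖ ≤ θ' * η)
    (ha : ∀ j, 0 ≤ a j) (hP : L ^ m ∣ P) {ε' : ℕ → ℝ} (hε' : ∀ i, 0 ≤ ε' i)
    (hTu : ∀ j, j ≤ m → ∀ (z y : Site d), bgT L U₀ j z y ∈ unitaryUnits 𝔸)
    (hTε : ∀ i, i < m → ∀ (w : Site d), ‖((bgT L U₀ i (blockMap L w) w : 𝔸ˣ) : 𝔸) - 1‖ ≤ ε' i)
    {κ' : ℝ} (hκ0 : 0 ≤ κ') (hκ : ∀ j ∈ Finset.range (m + 1), a j * ((((L : ℝ) ^ d) ^ j)⁻¹ * (∑ i ∈ Finset.range j, ε' i) ^ 2) ≤ κ')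
    {a₀ : ℝ} (hco : ∀ f : perSub (𝔸 := 𝔸) (d := d) P, a₀ * formPer τ P f f ≤ formPer τ P f (deltaPrimeAPer L (1 : Site d → Fin d → 𝔸ˣ) η m a Λs P f))
    (f : perSub (𝔸 := 𝔸) (d := d) P) :
    (a₀ / 2 - (2 * Cu * Cl) ^ 2 * (d * θ' ^ 2 + κ' * (m + 1))) * formPer τ P f f ≤ formPer τ P f (deltaPrimeAPer L U₀ η m a Λs P f) := by
  set C : ℝ := 2 * Cu * Cl with hC
  have hC0 : 0 ≤ C := by positivity
  -- the τ-size hypotheses with `θ := Cθ′`, `ε := Cε′`, `κ := C²κ′`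
  have hRτ : ∀ (x : Site d) (μ : Fin d) (b : 𝔸), fnorm τ (conjR (U₀ x μ) b - b) ≤ (C * θ') * η * fnorm τ b := by
    intro x μ b
    refine (fnorm_conjR_sub_le_of_cmp τ hCu hCl hCu0 (hUu x μ) b).trans ?_
    rw [← hC]
    have hb := fnorm_nonneg τ b
    calc C * ‖((U₀ x μ : 𝔸ˣ) : 𝔸) - 1‖ * fnorm τ b ≤ C * (θ' * η) * fnorm τ b :=
          mul_le_mul_of_nonneg_right (mul_le_mul_of_nonneg_left (hR x μ) hC0) hb
      _ = (C * θ') * η * fnorm τ b := by ring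
  have hTτ : ∀ i, i < m → ∀ (w : Site d) (b : 𝔸), fnorm τ (conjR (bgT L U₀ i (blockMap L w) w) b - b) ≤ (C * ε' i) * fnorm τ b := by
    intro i hi w b
    refine (fnorm_conjR_sub_le_of_cmp τ hCu hCl hCu0 (hTu i hi.le _ _) b).trans ?_
    rw [← hC]
    exact mul_le_mul_of_nonneg_right (mul_le_mul_of_nonneg_left (hTε i hi w) hC0) (fnorm_nonneg τ b)
  have hκτ : ∀ j ∈ Finset.range (m + 1), a j * ((((L : ℝ) ^ d) ^ j)⁻¹ * (∑ i ∈ Finset.range j, C * ε' i) ^ 2) ≤ C ^ 2 * κ' := by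
    intro j hj
    rw [← Finset.mul_sum, mul_pow]
    calc a j * ((((L : ℝ) ^ d) ^ j)⁻¹ * (C ^ 2 * (∑ i ∈ Finset.range j, ε' i) ^ 2))
        = C ^ 2 * (a j * ((((L : ℝ) ^ d) ^ j)⁻¹ * (∑ i ∈ Finset.range j, ε' i) ^ 2)) := by ring
      _ ≤ C ^ 2 * κ' := mul_le_mul_of_nonneg_left (hκ j hj) (sq_nonneg C)
  have h := coercive_near_flat_per τ hτp hτt hτs hη hUu hU hRτ ha hP (fun i => mul_nonneg hC0 (hε' i)) hTu hTτ (by positivity) hκτ hco f (Λs := Λs)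
  have hconst : a₀ / 2 - (2 * Cu * Cl) ^ 2 * (d * θ' ^ 2 + κ' * (m + 1)) = a₀ / 2 - d * (C * θ') ^ 2 - C ^ 2 * κ' * (m + 1) := by rw [hC]; ring
  rw [hconst]
  exact h

end OperatorNorm

/-! ## §2  The class reading: transporters' unitarity and closeness from the class's own smallness -/

section Class

variable {P L : ℕ} [NeZero P] [NeZero L] {η : ℝ} {U₀ : Site d → Fin d → 𝔸ˣ} {m k : ℕ} {a : ℕ → ℝ} {Λs : ℕ → Set (Site d)}

include hτp hτt hτs in
/-- ★★★ **NEAR-FLAT COERCIVITY AT EVERY BACKGROUND OF THE SMALL-FIELD CLASS OF THE TORUS**: for a unitary `P`-periodic `U₀` with `‖U₀(b) − 1‖ ≤ θ′η` on all bonds and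
`pdev U₀ < α₀(L^k)^{−2}` (`0 < α₀`, `C0·α₀ ≤ 1∕3`, `2α₀ ≤ c2′`), `2 ≤ L`, `m ≤ k`, `(L^k)^{−1} ≤ η`, `ηLʲ ≤ 1` and `a_jη²(Lʲ)² ≤ A(Lʲ)ᵈ` for `j ≤ m`, `a ≥ 0`, `Lᵐ ∣ P`,
norm-comparison constants `C_u, C_l`, and a flat coercivity `a₀⟨f,f⟩ ≤ ⟨f, Δ′_a(1)f⟩`:
`(a₀∕2 − (2C_uC_l)²·(dθ′² + A·d²L²·(256(d+1)(d+4)α₀ + θ′)²·(m+1)))·⟨f, f⟩_{T_P} ≤ ⟨f, Δ′_a(U₀)f⟩_{T_P}` — one constant for the class; the tower transporters are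
unitary (`j ≤ k`) and `ε′_i`-close to `1` by the NE9 area law (`B9Thm31NearFlatTransportersZd`).
[cite: Balaban1985BackgroundPropagators, Thm 3.11 p.416 («uniformly in U»), (3.35) p.396, (3.24) p.394; Balaban1985Averaging, Prop. 2 (52)–(54) p.26, (42)–(43) pp.23–24, (78)–(80) p.30; Balaban1985RegularSpaces, (1.131) p.99] -/
theorem coercive_near_flat_per_of_class {Cu Cl : ℝ} (hCu : ∀ b : 𝔸, fnorm τ b ≤ Cu * ‖b‖) (hCl : ∀ b : 𝔸, ‖b‖ ≤ Cl * fnorm τ b) (hCu0 : 0 ≤ Cu) (hCl0 : 0 ≤ Cl)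
    (hL : 2 ≤ L) (hη : 0 < η) (hUu : ∀ (x : Site d) (κ' : Fin d), U₀ x κ' ∈ unitaryUnits 𝔸) (hU : IsPeriodic P U₀)
    {θ' : ℝ} (hθ' : 0 ≤ θ') (hR : ∀ (x : Site d) (μ : Fin d), ‖((U₀ x μ : 𝔸ˣ) : 𝔸) - 1‖ ≤ θ' * η)
    {α₀ : ℝ} (hα : 0 < α₀) (hα3 : C0 d * α₀ ≤ 1 / 3) (hα2 : 2 * α₀ ≤ c2' d L) (h52 : pdev U₀ < α₀ * (((L : ℝ) ^ k)⁻¹) ^ 2)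
    (hm : m ≤ k) (hkη : ((L : ℝ) ^ k)⁻¹ ≤ η) (hηL : ∀ j ∈ Finset.range (m + 1), η * (L : ℝ) ^ j ≤ 1)
    (ha : ∀ j, 0 ≤ a j) {A : ℝ} (haA : ∀ j ∈ Finset.range (m + 1), a j * η ^ 2 * ((L : ℝ) ^ j) ^ 2 ≤ A * ((L : ℝ) ^ j) ^ d) (hP : L ^ m ∣ P)
    {a₀ : ℝ} (hco : ∀ f : perSub (𝔸 := 𝔸) (d := d) P, a₀ * formPer τ P f f ≤ formPer τ P f (deltaPrimeAPer L (1 : Site d → Fin d → 𝔸ˣ) η m a Λs P f))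
    (f : perSub (𝔸 := 𝔸) (d := d) P) :
    (a₀ / 2 - (2 * Cu * Cl) ^ 2 * (d * θ' ^ 2 + A * d ^ 2 * (L : ℝ) ^ 2 * (256 * (d + 1) * (d + 4) * α₀ + θ') ^ 2 * (m + 1))) * formPer τ P f f ≤
      formPer τ P f (deltaPrimeAPer L U₀ η m a Λs P f) := by
  have hδ0 : 0 ≤ θ' * η := mul_nonneg hθ' hη.le
  -- the tower transporters of the class: unitary up to level `m ≤ k`, and `ε′_i`-close to `1` on the tower pairs
  have hTu : ∀ j, j ≤ m → ∀ z y : Site d, bgT L U₀ j z y ∈ unitaryUnits 𝔸 :=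
    fun j hj z y => bgT_mem_unitaryUnits_of_pdev hL k hUu hα hα3 hα2 h52 (hj.trans hm) z y
  have hTε : ∀ i, i < m → ∀ (w : Site d),
      ‖((bgT L U₀ i (blockMap L w) w : 𝔸ˣ) : 𝔸) - 1‖ ≤
        d * L * (256 * (d + 1) * (d + 4) * α₀ * ((L : ℝ) ^ i * ((L : ℝ) ^ k)⁻¹) ^ 2 + (L : ℝ) ^ i * (θ' * η)) :=
    fun i hi w => norm_bgT_pair_sub_one_le hL k hUu hα hα3 hα2 h52 hδ0 hR (by omega) w
  have hε' : ∀ i : ℕ, 0 ≤ d * L * (256 * (d + 1) * (d + 4) * α₀ * ((L : ℝ) ^ i * ((L : ℝ) ^ k)⁻¹) ^ 2 + (L : ℝ) ^ i * (θ' * η)) :=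
    fun i => by positivity
  have hA : 0 ≤ A := by
    -- from the upper weight bound at `j = 0`: `0 ≤ a₀·η²·1 ≤ A·1`
    have h0 : (0 : ℕ) ∈ Finset.range (m + 1) := Finset.mem_range.2 (Nat.succ_pos m)
    have h2 := haA 0 h0
    have h3 : 0 ≤ a 0 * η ^ 2 * ((L : ℝ) ^ 0) ^ 2 := mul_nonneg (mul_nonneg (ha 0) (sq_nonneg η)) (sq_nonneg _)
    rw [pow_zero, one_pow, mul_one, one_pow, mul_one] at h2
    rw [pow_zero, one_pow, mul_one] at h3
    exact h3.trans h2
  have hκ0 : 0 ≤ A * d ^ 2 * (L : ℝ) ^ 2 * (256 * (d + 1) * (d + 4) * α₀ + θ') ^ 2 := by positivity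
  exact coercive_near_flat_per_of_norm τ hτp hτt hτs hCu hCl hCu0 hCl0 hη hUu hU hR ha hP hε' hTu hTε hκ0
    (fun j hj => sum_eps_sq_weight_le hL hη hkη hηL hθ' hα.le ha haA hj) hco f

include hτp hτt hτs in
/-- ★★★ **THE SCALAR CLAUSE OF THEOREM 3.11 ON THE TORUS, «UNIFORMLY IN U»: `Δ′_a(U₀)` IS INVERTIBLE ON `L²(T_P)` AT EVERY BACKGROUND OF THE CLASS** — under the
hypotheses of `coercive_near_flat_per_of_class` with a POSITIVE margin `(2C_uC_l)²(dθ′² + Ad²L²(256(d+1)(d+4)α₀ + θ′)²(m+1)) < a₀∕2` (finite-dimensional fibre):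
`RegularPrimePer L U₀ η m a Λs P` (so that `G′(U₀) = (Δ′_a(U₀))⁻¹`, `GpPer`, inverts it there).
[cite: Balaban1985BackgroundPropagators, Thm 3.11 p.416, (3.24) p.394 («Its inverse is denoted by G′»), (3.35) p.396; Balaban1985Averaging, Prop. 2 p.26] -/
theorem regularPrimePer_of_class [FiniteDimensional ℝ 𝔸] {Cu Cl : ℝ} (hCu : ∀ b : 𝔸, fnorm τ b ≤ Cu * ‖b‖) (hCl : ∀ b : 𝔸, ‖b‖ ≤ Cl * fnorm τ b)
    (hCu0 : 0 ≤ Cu) (hCl0 : 0 ≤ Cl) (hL : 2 ≤ L) (hη : 0 < η) (hUu : ∀ (x : Site d) (κ' : Fin d), U₀ x κ' ∈ unitaryUnits 𝔸) (hU : IsPeriodic P U₀)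
    {θ' : ℝ} (hθ' : 0 ≤ θ') (hR : ∀ (x : Site d) (μ : Fin d), ‖((U₀ x μ : 𝔸ˣ) : 𝔸) - 1‖ ≤ θ' * η)
    {α₀ : ℝ} (hα : 0 < α₀) (hα3 : C0 d * α₀ ≤ 1 / 3) (hα2 : 2 * α₀ ≤ c2' d L) (h52 : pdev U₀ < α₀ * (((L : ℝ) ^ k)⁻¹) ^ 2)
    (hm : m ≤ k) (hkη : ((L : ℝ) ^ k)⁻¹ ≤ η) (hηL : ∀ j ∈ Finset.range (m + 1), η * (L : ℝ) ^ j ≤ 1)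
    (ha : ∀ j, 0 ≤ a j) {A : ℝ} (haA : ∀ j ∈ Finset.range (m + 1), a j * η ^ 2 * ((L : ℝ) ^ j) ^ 2 ≤ A * ((L : ℝ) ^ j) ^ d) (hP : L ^ m ∣ P)
    {a₀ : ℝ} (hco : ∀ f : perSub (𝔸 := 𝔸) (d := d) P, a₀ * formPer τ P f f ≤ formPer τ P f (deltaPrimeAPer L (1 : Site d → Fin d → 𝔸ˣ) η m a Λs P f))
    (hmargin : (2 * Cu * Cl) ^ 2 * (d * θ' ^ 2 + A * d ^ 2 * (L : ℝ) ^ 2 * (256 * (d + 1) * (d + 4) * α₀ + θ') ^ 2 * (m + 1)) < a₀ / 2) :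
    RegularPrimePer L U₀ η m a Λs P := by
  refine bijective_of_form_pos τ fun f hf => lt_of_lt_of_le ?_
    (coercive_near_flat_per_of_class τ hτp hτt hτs hCu hCl hCu0 hCl0 hL hη hUu hU hθ' hR hα hα3 hα2 h52 hm hkη hηL ha haA hP hco f)
  have hnn : 0 ≤ formPer τ P f f := by
    rw [formPer_apply]
    exact Finset.sum_nonneg fun x _ => by rw [← fnorm_sq hτp]; exact sq_nonneg _
  have hpos : 0 < formPer τ P f f := by
    rcases hnn.lt_or_eq with h | h
    · exact h
    · exact absurd (B9Eq321LandauProjectionZdPer.formPer_apply_self_eq_zero τ P hτp h.symm) hf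
  exact mul_pos (by linarith) hpos

include hτp hτt hτs in
/-- ★★ **THE CLASS COERCIVITY WITH THE FLAT CONSTANT SUPPLIED** (`B9Thm31FlatPoincareCoerciveZdPer.formPer_deltaPrimeAPer_one_coercive`): if moreover the level-`m`
constraint set covers the level-`m` cell, `a₀ ≤ 8` and `a₀((Lᵐ))ᵈ ≤ a_mη²(Lᵐ)²` (finite-dimensional fibre), then at every background of the class
`(a₀∕2 − (2C_uC_l)²·(dθ′² + Ad²L²(256(d+1)(d+4)α₀ + θ′)²(m+1)))·⟨f, f⟩_{T_P} ≤ ⟨f, Δ′_a(U₀)f⟩_{T_P}` with NO displayed coercivity hypothesis.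
[cite: Balaban1985BackgroundPropagators, Thm 3.11 p.416, (3.24) p.394, (3.35) p.396; Balaban1984PropagatorsII, (2.22) p.226; Balaban1985Averaging, Prop. 2 p.26; Balaban1985RegularSpaces, (1.28) p.81, p.77] -/
theorem coercive_near_flat_per_torusLam_of_class [FiniteDimensional ℝ 𝔸] {Cu Cl : ℝ} (hCu : ∀ b : 𝔸, fnorm τ b ≤ Cu * ‖b‖) (hCl : ∀ b : 𝔸, ‖b‖ ≤ Cl * fnorm τ b)
    (hCu0 : 0 ≤ Cu) (hCl0 : 0 ≤ Cl) (hL : 2 ≤ L) (hη : 0 < η) (hUu : ∀ (x : Site d) (κ' : Fin d), U₀ x κ' ∈ unitaryUnits 𝔸) (hU : IsPeriodic P U₀)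
    {θ' : ℝ} (hθ' : 0 ≤ θ') (hR : ∀ (x : Site d) (μ : Fin d), ‖((U₀ x μ : 𝔸ˣ) : 𝔸) - 1‖ ≤ θ' * η)
    {α₀ : ℝ} (hα : 0 < α₀) (hα3 : C0 d * α₀ ≤ 1 / 3) (hα2 : 2 * α₀ ≤ c2' d L) (h52 : pdev U₀ < α₀ * (((L : ℝ) ^ k)⁻¹) ^ 2)
    (hm : m ≤ k) (hkη : ((L : ℝ) ^ k)⁻¹ ≤ η) (hηL : ∀ j ∈ Finset.range (m + 1), η * (L : ℝ) ^ j ≤ 1)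
    (ha : ∀ j, 0 ≤ a j) {A : ℝ} (haA : ∀ j ∈ Finset.range (m + 1), a j * η ^ 2 * ((L : ℝ) ^ j) ^ 2 ≤ A * ((L : ℝ) ^ j) ^ d) (hP : L ^ m ∣ P)
    (hΛm : ∀ y ∈ box (d := d) (P / L ^ m), y ∈ Λs m) {a₀ : ℝ} (ha₀8 : a₀ ≤ 8) (ha₀ : a₀ * ((L : ℝ) ^ m) ^ d ≤ a m * η ^ 2 * ((L : ℝ) ^ m) ^ 2)
    (f : perSub (𝔸 := 𝔸) (d := d) P) :
    (a₀ / 2 - (2 * Cu * Cl) ^ 2 * (d * θ' ^ 2 + A * d ^ 2 * (L : ℝ) ^ 2 * (256 * (d + 1) * (d + 4) * α₀ + θ') ^ 2 * (m + 1))) * formPer τ P f f ≤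
      formPer τ P f (deltaPrimeAPer L U₀ η m a Λs P f) := by
  have hηLm : η * (L : ℝ) ^ m ≤ 1 := hηL m (Finset.mem_range.2 (Nat.lt_succ_self m))
  exact coercive_near_flat_per_of_class τ hτp hτt hτs hCu hCl hCu0 hCl0 hL hη hUu hU hθ' hR hα hα3 hα2 h52 hm hkη hηL ha haA hP
    (fun g => formPer_deltaPrimeAPer_one_coercive τ hτp hτs hη hηLm ha ha₀8 ha₀ hP hΛm hτt g) f

end Class

/-! ## §3  A6 ∕ non-vacuity: the flat background is in the class -/

section Witness

variable {P L : ℕ} [NeZero P] [NeZero L] {η : ℝ} {m k : ℕ} {a : ℕ → ℝ} {Λs : ℕ → Set (Site d)}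

include hτp hτt hτs in
/-- **A6 — THE FLAT BACKGROUND IS IN THE CLASS**: at `U₀ = 1` (`pdev 1 = 0`, `‖1 − 1‖ = 0 ≤ 0·η`) `coercive_near_flat_per_of_class` applies with `θ′ = 0` for every admissible
`α₀`: `(a₀∕2 − (2C_uC_l)²·Ad²L²(256(d+1)(d+4)α₀)²(m+1))·⟨f, f⟩_{T_P} ≤ ⟨f, Δ′_a(1)f⟩_{T_P}` (as `α₀ ↓ 0` the constant tends to `a₀∕2`).
[cite: Balaban1985BackgroundPropagators, Thm 3.11 p.416; Balaban1984PropagatorsII, (2.22) p.226; Balaban1985RegularSpaces, (1.131) p.99] -/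
theorem coercive_one_per_of_class {Cu Cl : ℝ} (hCu : ∀ b : 𝔸, fnorm τ b ≤ Cu * ‖b‖) (hCl : ∀ b : 𝔸, ‖b‖ ≤ Cl * fnorm τ b) (hCu0 : 0 ≤ Cu) (hCl0 : 0 ≤ Cl)
    (hL : 2 ≤ L) (hη : 0 < η) {α₀ : ℝ} (hα : 0 < α₀) (hα3 : C0 d * α₀ ≤ 1 / 3) (hα2 : 2 * α₀ ≤ c2' d L)
    (hm : m ≤ k) (hkη : ((L : ℝ) ^ k)⁻¹ ≤ η) (hηL : ∀ j ∈ Finset.range (m + 1), η * (L : ℝ) ^ j ≤ 1)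
    (ha : ∀ j, 0 ≤ a j) {A : ℝ} (haA : ∀ j ∈ Finset.range (m + 1), a j * η ^ 2 * ((L : ℝ) ^ j) ^ 2 ≤ A * ((L : ℝ) ^ j) ^ d) (hP : L ^ m ∣ P)
    {a₀ : ℝ} (hco : ∀ f : perSub (𝔸 := 𝔸) (d := d) P, a₀ * formPer τ P f f ≤ formPer τ P f (deltaPrimeAPer L (1 : Site d → Fin d → 𝔸ˣ) η m a Λs P f))
    (f : perSub (𝔸 := 𝔸) (d := d) P) :
    (a₀ / 2 - (2 * Cu * Cl) ^ 2 * (A * d ^ 2 * (L : ℝ) ^ 2 * (256 * (d + 1) * (d + 4) * α₀) ^ 2 * (m + 1))) * formPer τ P f f ≤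
      formPer τ P f (deltaPrimeAPer L (1 : Site d → Fin d → 𝔸ˣ) η m a Λs P f) := by
  have hone : ∀ (x : Site d) (κ' : Fin d), (1 : Site d → Fin d → 𝔸ˣ) x κ' ∈ unitaryUnits 𝔸 := fun _ _ => (unitaryUnits 𝔸).one_mem
  have hper : IsPeriodic P (1 : Site d → Fin d → 𝔸ˣ) := fun _ _ => rfl
  have hR : ∀ (x : Site d) (μ : Fin d), ‖(((1 : Site d → Fin d → 𝔸ˣ) x μ : 𝔸ˣ) : 𝔸) - 1‖ ≤ 0 * η := by
    intro x μ
    simp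
  have hpdev : pdev (1 : Site d → Fin d → 𝔸ˣ) < α₀ * (((L : ℝ) ^ k)⁻¹) ^ 2 := by
    have h0 : pdev (1 : Site d → Fin d → 𝔸ˣ) = 0 := by unfold pdev; simp [B8Ineq130.hol_one]
    rw [h0]
    have hL0 : (0 : ℝ) < (L : ℝ) := by exact_mod_cast (lt_of_lt_of_le (by norm_num) hL)
    positivity
  have h := coercive_near_flat_per_of_class τ hτp hτt hτs hCu hCl hCu0 hCl0 hL hη hone hper le_rfl hR hα hα3 hα2 hpdev hm hkη hηL ha haA hP hco f
    (Λs := Λs)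
  have he : a₀ / 2 - (2 * Cu * Cl) ^ 2 * (d * (0 : ℝ) ^ 2 + A * d ^ 2 * (L : ℝ) ^ 2 * (256 * (d + 1) * (d + 4) * α₀ + 0) ^ 2 * (m + 1)) =
      a₀ / 2 - (2 * Cu * Cl) ^ 2 * (A * d ^ 2 * (L : ℝ) ^ 2 * (256 * (d + 1) * (d + 4) * α₀) ^ 2 * (m + 1)) := by ring
  rw [he] at h
  exact h

end Witness

end Literature.MathematicalPhysics.QuantumFieldTheory.Balaban1983to89.B9Thm31NearFlatCoerciveClassZdPer
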